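import Mathlib.Probability.Independence.Integration
import Mathlib.Analysis.SpecialFunctions.Pow.Real

/-!
# Sign patterns on a finite product and Littlewood–Offord in product form

Helper for stub `stub_spreadFromParts` (S6) of line `free-volume-heavy-witness`
(crux `Summit.QuantumFields.QCD.Theses.SpectralDefectExtinction.WindowExtinction`,
item stmt-QuantumFields-8964).  Pure measure theory / combinatorics, no project vocabulary.

On `J → T` with the product `ν^{⊗J}` of a probability measure and two disjoint measurable
"template classes" `Tp, Tm ⊆ T`:

* `spread_lintegral_prod_pi` — `∫ ∏ᵢ gᵢ(qᵢ) dν^{⊗J} = ∏ᵢ ∫ gᵢ dν` (independence of the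
  coordinates, Mathlib `iIndepFun_pi`);
* `spread_lintegral_pattern` — on the active box `(Tp ∪ Tm)^J` the integral of
  `[P(sign pattern)] ∏ᵢ Fᵢ(qᵢ)` is the pattern sum `∑_{σ : P σ} ∏ᵢ ∫_{T(σᵢ)} Fᵢ dν`
  (`T(true) = Tp`, `T(false) = Tm`);
* `spread_lo_product` — the Littlewood–Offord input (atoms of `∑ ±1` for independent
  non-degenerate signs are `≤ C/√(N+1)`, stated for `Fin N`) in product form over any finite
  index type: `∑_{σ : ∑ ±σ = k} ∏ᵢ wᵢ(σᵢ) ≤ C/√(|J|+1) · ∏ᵢ (wᵢ tt + wᵢ ff)`;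
* `spread_ratio_bounds` — non-degeneracy `pᵢ ∈ [ε, 1-ε]` of the induced signs from a bounded
  oscillation of the one-coordinate log-weights.
-/

noncomputable section

namespace Summit.QuantumFields.QCD.Cruxes.WindowExtinction.FreeVolumeHeavyWitness

open MeasureTheory ProbabilityTheory Set
open scoped ENNReal BigOperators Classical

variable {J T : Type*} [Fintype J] [MeasurableSpace T]

/-! ## Product integrals -/

/-- **Independence of the coordinates**: `∫ ∏ᵢ gᵢ(qᵢ) dν^{⊗J} = ∏ᵢ ∫ gᵢ dν` for a probability
measure `ν` and measurable `gᵢ ≥ 0`. -/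
theorem spread_lintegral_prod_pi (ν : Measure T) [IsProbabilityMeasure ν] {g : J → T → ℝ≥0∞}
    (hg : ∀ i, Measurable (g i)) :
    ∫⁻ q, ∏ i, g i (q i) ∂Measure.pi (fun _ : J => ν) = ∏ i, ∫⁻ u, g i u ∂ν := by
  have hind : iIndepFun (fun i (q : J → T) => g i (q i)) (Measure.pi fun _ : J => ν) :=
    iIndepFun_pi (X := g) fun i => (hg i).aemeasurable
  have h := lintegral_prod_eq_prod_lintegral_of_indepFun Finset.univ
    (fun i (q : J → T) => g i (q i)) hind fun i => (hg i).comp (measurable_pi_apply i)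
  rw [h]
  refine Finset.prod_congr rfl fun i _ => ?_
  exact (measurePreserving_eval (fun _ : J => ν) i).lintegral_comp (hg i)

/-! ## Sign patterns -/

omit [MeasurableSpace T] in
/-- Pointwise pattern decomposition on the active box: for `q ∈ (Tp ∪ Tm)^J` exactly one sign
pattern `σ` has `qᵢ ∈ T(σᵢ)` for all `i`, namely `σᵢ = [qᵢ ∈ Tp]`; off the box every pattern
misses. -/
theorem spread_pattern_pointwise [DecidableEq J] {Tp Tm : Set T} (hdisj : Disjoint Tp Tm)
    (F : J → T → ℝ≥0∞)
    (P : (J → Bool) → Prop) [DecidablePred P] (q : J → T) :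
    (Set.pi Set.univ fun _ : J => Tp ∪ Tm).indicator
        (fun q => if P (fun i => decide (q i ∈ Tp)) then ∏ i, F i (q i) else 0) q =
      ∑ σ ∈ Finset.univ.filter P, ∏ i, (if σ i then Tp else Tm).indicator (F i) (q i) := by
  by_cases hq : ∀ i, q i ∈ Tp ∪ Tm
  · have hmem : q ∈ Set.pi Set.univ fun _ : J => Tp ∪ Tm := fun i _ => hq i
    rw [Set.indicator_of_mem hmem, Finset.sum_filter]
    set σq : J → Bool := fun i => decide (q i ∈ Tp) with hσq
    -- every other pattern misses
    have hmiss : ∀ σ : J → Bool, σ ≠ σq →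
        ∏ i, (if σ i then Tp else Tm).indicator (F i) (q i) = 0 := by
      intro σ hσ
      obtain ⟨i, hi⟩ : ∃ i, σ i ≠ σq i := by
        by_contra h
        push Not at h
        exact hσ (funext h)
      refine Finset.prod_eq_zero (Finset.mem_univ i) ?_
      refine Set.indicator_of_notMem ?_ _
      cases hσi : σ i
      · -- `σ i = false`: need `q i ∉ Tm`; but `σq i = true`, i.e. `q i ∈ Tp`
        have : σq i = true := by
          cases h' : σq i
          · exact absurd (hσi.trans h'.symm) hi
          · rfl
        have hp : q i ∈ Tp := by simpa [hσq] using this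
        simp only [Bool.false_eq_true, ↓reduceIte]
        exact Set.disjoint_left.1 hdisj hp
      · have : σq i = false := by
          cases h' : σq i
          · rfl
          · exact absurd (hσi.trans h'.symm) hi
        have hp : q i ∉ Tp := by simpa [hσq] using this
        simpa using hp
    -- the matching pattern hits
    have hhit : ∏ i, (if σq i then Tp else Tm).indicator (F i) (q i) = ∏ i, F i (q i) := by
      refine Finset.prod_congr rfl fun i _ => Set.indicator_of_mem ?_ _
      by_cases hp : q i ∈ Tp
      · have : σq i = true := by simp [hσq, hp]
        rw [this]; simpa using hp
      · have : σq i = false := by simp [hσq, hp]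
        rw [this]
        simpa using (hq i).resolve_left hp
    rw [Finset.sum_eq_single σq (fun σ _ hσ => by rw [hmiss σ hσ, ite_self]) (fun h => absurd
      (Finset.mem_univ _) h), hhit]
  · have hnot : q ∉ Set.pi Set.univ fun _ : J => Tp ∪ Tm := fun h => hq fun i => h i (mem_univ _)
    rw [Set.indicator_of_notMem hnot]
    push Not at hq
    obtain ⟨i, hi⟩ := hq
    symm
    refine Finset.sum_eq_zero fun σ _ => Finset.prod_eq_zero (Finset.mem_univ i) ?_
    have : q i ∉ (if σ i then Tp else Tm) := by
      cases σ i
      · simpa using fun h => hi (Or.inr h)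
      · simpa using fun h => hi (Or.inl h)
    exact Set.indicator_of_notMem this _

/-- **Pattern sum.** On the active box the integral of `[P(pattern)] ∏ᵢ Fᵢ(qᵢ)` against `ν^{⊗J}`
is `∑_{σ : P σ} ∏ᵢ ∫ 1_{T(σᵢ)} Fᵢ dν`. -/
theorem spread_lintegral_pattern [DecidableEq J] (ν : Measure T) [IsProbabilityMeasure ν]
    {Tp Tm : Set T}
    (hTp : MeasurableSet Tp) (hTm : MeasurableSet Tm) (hdisj : Disjoint Tp Tm)
    {F : J → T → ℝ≥0∞} (hF : ∀ i, Measurable (F i)) (P : (J → Bool) → Prop) [DecidablePred P] :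
    ∫⁻ q, (Set.pi Set.univ fun _ : J => Tp ∪ Tm).indicator
        (fun q => if P (fun i => decide (q i ∈ Tp)) then ∏ i, F i (q i) else 0) q
        ∂Measure.pi (fun _ : J => ν) =
      ∑ σ ∈ Finset.univ.filter P, ∏ i, ∫⁻ u, (if σ i then Tp else Tm).indicator (F i) u ∂ν := by
  have hmeas : ∀ (σ : J → Bool) (i : J), Measurable ((if σ i then Tp else Tm).indicator (F i)) :=
    fun σ i => (hF i).indicator (by cases σ i <;> simp [hTp, hTm])
  simp_rw [spread_pattern_pointwise hdisj F P]
  rw [lintegral_finsetSum _ fun σ _ => ?_]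
  · exact Finset.sum_congr rfl fun σ _ => spread_lintegral_prod_pi ν (hmeas σ)
  · exact Finset.measurable_prod _ fun i _ => (hmeas σ i).comp (measurable_pi_apply i)

omit [MeasurableSpace T] in
/-- The calibrated sign of an active value is `±1` according to its pattern bit. -/
theorem spread_sign_eq_of_mem {Tp Tm : Set T} {u : T} (hu : u ∈ Tp ∪ Tm) :
    (if u ∈ Tp then (1 : ℤ) else if u ∈ Tm then -1 else 0) =
      if decide (u ∈ Tp) then (1 : ℤ) else -1 := by
  by_cases hp : u ∈ Tp
  · simp [hp]
  · simp [hp, hu.resolve_left hp]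

/-- **Pattern sum for the atoms of the sign statistic**: on the active box,
`∫ [∑ᵢ sgn qᵢ = k] ∏ᵢ Fᵢ(qᵢ) dν^{⊗J} = ∑_{σ : ∑ ±σ = k} ∏ᵢ ∫ 1_{T(σᵢ)} Fᵢ dν`. -/
theorem spread_lintegral_pattern_atom [DecidableEq J] (ν : Measure T) [IsProbabilityMeasure ν]
    {Tp Tm : Set T}
    (hTp : MeasurableSet Tp) (hTm : MeasurableSet Tm) (hdisj : Disjoint Tp Tm)
    {F : J → T → ℝ≥0∞} (hF : ∀ i, Measurable (F i)) (k : ℤ) :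
    ∫⁻ q, (Set.pi Set.univ fun _ : J => Tp ∪ Tm).indicator
        (fun q => if (∑ i, (if q i ∈ Tp then (1 : ℤ) else if q i ∈ Tm then -1 else 0)) = k
          then ∏ i, F i (q i) else 0) q ∂Measure.pi (fun _ : J => ν) =
      ∑ σ ∈ (Finset.univ : Finset (J → Bool)).filter
          (fun σ => (∑ i, (if σ i then (1 : ℤ) else -1)) = k),
        ∏ i, ∫⁻ u, (if σ i then Tp else Tm).indicator (F i) u ∂ν := by
  rw [← spread_lintegral_pattern ν hTp hTm hdisj hF (fun σ => (∑ i, (if σ i then (1 : ℤ) else -1)) = k)]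
  refine lintegral_congr fun q => ?_
  by_cases hq : q ∈ Set.pi Set.univ fun _ : J => Tp ∪ Tm
  · rw [Set.indicator_of_mem hq, Set.indicator_of_mem hq]
    have : (∑ i, (if q i ∈ Tp then (1 : ℤ) else if q i ∈ Tm then -1 else 0)) =
        ∑ i, (if decide (q i ∈ Tp) then (1 : ℤ) else -1) :=
      Finset.sum_congr rfl fun i _ => spread_sign_eq_of_mem (hq i (mem_univ _))
    simp only [this]
  · rw [Set.indicator_of_notMem hq, Set.indicator_of_notMem hq]

/-- **Total mass on the active box**: `∫_{(Tp∪Tm)^J} ∏ᵢ Fᵢ(qᵢ) dν^{⊗J} = ∑_σ ∏ᵢ ∫ 1_{T(σᵢ)} Fᵢ`. -/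
theorem spread_lintegral_pattern_total [DecidableEq J] (ν : Measure T) [IsProbabilityMeasure ν]
    {Tp Tm : Set T}
    (hTp : MeasurableSet Tp) (hTm : MeasurableSet Tm) (hdisj : Disjoint Tp Tm)
    {F : J → T → ℝ≥0∞} (hF : ∀ i, Measurable (F i)) :
    ∫⁻ q, (Set.pi Set.univ fun _ : J => Tp ∪ Tm).indicator (fun q => ∏ i, F i (q i)) q
        ∂Measure.pi (fun _ : J => ν) =
      ∑ σ : J → Bool, ∏ i, ∫⁻ u, (if σ i then Tp else Tm).indicator (F i) u ∂ν := by
  have h := spread_lintegral_pattern ν hTp hTm hdisj hF (fun _ => True)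
  simp only [if_true, Finset.filter_true] at h
  exact h

/-! ## Littlewood–Offord in product form -/

/-- The Littlewood–Offord constant is at least `1` (take `N = 0`, `k = 0`). -/
theorem spread_lo_const_ge_one {ε C : ℝ}
    (hLO : ∀ (N : ℕ) (p : Fin N → ℝ), (∀ i, ε ≤ p i ∧ p i ≤ 1 - ε) → ∀ k : ℤ,
      (∑ s ∈ (Finset.univ : Finset (Fin N → Bool)).filter
          (fun s => (∑ i, (if s i then (1 : ℤ) else -1)) = k),
        ∏ i, (if s i then p i else 1 - p i)) ≤ C / Real.sqrt (N + 1)) :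
    1 ≤ C := by
  have h := hLO 0 Fin.elim0 (fun i => Fin.elim0 i) 0
  simp at h
  exact h

/-- **Littlewood–Offord, product form.** For real weights `wᵢ(tt), wᵢ(ff)` with
`wᵢ(tt) + wᵢ(ff) > 0` and `pᵢ = wᵢ(tt)/(wᵢ(tt)+wᵢ(ff)) ∈ [ε, 1-ε]`, every atom of the pattern
sum is small: `∑_{σ : ∑ ±σ = k} ∏ᵢ wᵢ(σᵢ) ≤ C/√(|J|+1) · ∏ᵢ (wᵢ tt + wᵢ ff)`. -/
theorem spread_lo_product :
    ∀ {J : Type*} [Fintype J] [DecidableEq J] {ε C : ℝ},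
      (∀ (N : ℕ) (p : Fin N → ℝ), (∀ i, ε ≤ p i ∧ p i ≤ 1 - ε) → ∀ k : ℤ,
        (∑ s ∈ (Finset.univ : Finset (Fin N → Bool)).filter
            (fun s => (∑ i, (if s i then (1 : ℤ) else -1)) = k),
          ∏ i, (if s i then p i else 1 - p i)) ≤ C / Real.sqrt (N + 1)) →
      ∀ (w : J → Bool → ℝ), (∀ i, 0 < w i true + w i false) →
      (∀ i, ε ≤ w i true / (w i true + w i false) ∧
        w i true / (w i true + w i false) ≤ 1 - ε) → ∀ (k : ℤ),
      (∑ σ ∈ (Finset.univ : Finset (J → Bool)).filter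
          (fun σ => (∑ i, (if σ i then (1 : ℤ) else -1)) = k), ∏ i, w i (σ i)) ≤
        C / Real.sqrt (Fintype.card J + 1) * ∏ i, (w i true + w i false) := by
  intro J _ _ ε C hLO w hpos hp k
  set n := Fintype.card J with hn
  set e : J ≃ Fin n := Fintype.equivFin J with he
  set tot : J → ℝ := fun i => w i true + w i false with htot
  set r : J → Bool → ℝ := fun i b => w i b / tot i with hr
  set p : Fin n → ℝ := fun m => r (e.symm m) true with hpdef
  have hr1 : ∀ i, r i false = 1 - r i true := fun i => by
    have h0 : tot i ≠ 0 := (hpos i).ne'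
    simp only [hr, htot] at h0 ⊢
    field_simp
    ring
  have hwr : ∀ i b, w i b = tot i * r i b := fun i b => by
    have h0 : tot i ≠ 0 := (hpos i).ne'
    simp only [hr]
    field_simp
  -- factor out the totals
  have hfac : ∀ σ : J → Bool, ∏ i, w i (σ i) = (∏ i, tot i) * ∏ i, r i (σ i) := fun σ => by
    rw [← Finset.prod_mul_distrib]
    exact Finset.prod_congr rfl fun i _ => hwr i (σ i)
  have hL : (∑ σ ∈ (Finset.univ : Finset (J → Bool)).filter
        (fun σ => (∑ i, (if σ i then (1 : ℤ) else -1)) = k), ∏ i, w i (σ i)) =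
      (∏ i, tot i) * ∑ σ ∈ (Finset.univ : Finset (J → Bool)).filter
        (fun σ => (∑ i, (if σ i then (1 : ℤ) else -1)) = k), ∏ i, r i (σ i) := by
    rw [Finset.mul_sum]
    exact Finset.sum_congr rfl fun σ _ => hfac σ
  -- transport the pattern sum to `Fin n`
  have hLO' := hLO n p (fun m => hp (e.symm m)) k
  have htrans : (∑ σ ∈ (Finset.univ : Finset (J → Bool)).filter
        (fun σ => (∑ i, (if σ i then (1 : ℤ) else -1)) = k), ∏ i, r i (σ i)) =
      ∑ s ∈ (Finset.univ : Finset (Fin n → Bool)).filter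
          (fun s => (∑ i, (if s i then (1 : ℤ) else -1)) = k),
        ∏ i, (if s i then p i else 1 - p i) := by
    rw [Finset.sum_filter, Finset.sum_filter]
    refine Fintype.sum_equiv (e.arrowCongr (Equiv.refl Bool)) _ _ fun σ => ?_
    have hs : ∀ m, (e.arrowCongr (Equiv.refl Bool)) σ m = σ (e.symm m) := fun m => rfl
    have hsum : (∑ i, (if σ i then (1 : ℤ) else -1)) =
        ∑ m, (if (e.arrowCongr (Equiv.refl Bool)) σ m then (1 : ℤ) else -1) := by
      simp only [hs]
      exact (Fintype.sum_equiv e _ _ fun i => by simp).trans rfl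
    have hprod : ∏ i, r i (σ i) =
        ∏ m, (if (e.arrowCongr (Equiv.refl Bool)) σ m then p m else 1 - p m) := by
      simp only [hs, hpdef]
      refine Fintype.prod_equiv e _ _ fun i => ?_
      simp only [Equiv.symm_apply_apply]
      cases σ i
      · simp [hr1]
      · simp
    rw [hsum, hprod]
  have htotpos : 0 < ∏ i, tot i := Finset.prod_pos fun i _ => hpos i
  rw [hL, htrans, mul_comm]
  exact mul_le_mul_of_nonneg_right hLO' htotpos.le

/-- The full pattern sum is the product of the totals: `∑_σ ∏ᵢ wᵢ(σᵢ) = ∏ᵢ (wᵢ tt + wᵢ ff)`. -/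
theorem spread_sum_pattern_prod [DecidableEq J] {M : Type*} [CommSemiring M] (w : J → Bool → M) :
    ∑ σ : J → Bool, ∏ i, w i (σ i) = ∏ i, (w i true + w i false) := by
  have h := Finset.prod_univ_sum (fun _ : J => (Finset.univ : Finset Bool)) w
  rw [Fintype.piFinset_univ] at h
  rw [← h]
  exact Finset.prod_congr rfl fun i _ => Fintype.sum_bool _

/-! ## Non-degeneracy of the induced signs -/

/-- **Ratio bounds.** If `b` oscillates by at most `B` on the active values and `u₀ ∈ Tp`, then
`∫_{Tp} e^b dν / ∫_{Tp ∪ Tm} e^b dν ≥ e^{-2B} ν(Tp)` and the complementary ratio is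
`≥ e^{-2B} ν(Tm)` (for a probability measure `ν`); stated with the two partial integrals
`GT = ∫_{Tp} e^b`, `GF = ∫_{Tm} e^b` and the reference value `b u₀`. -/
theorem spread_ratio_bounds {B b₀ GT GF mp mm : ℝ} (hmp : 0 < mp) (hmm : 0 ≤ mm)
    (hmpm : mp + mm ≤ 1)
    (hGT₁ : Real.exp (b₀ - B) * mp ≤ GT) (hGT₂ : GT ≤ Real.exp (b₀ + B) * mp)
    (hGF₁ : Real.exp (b₀ - B) * mm ≤ GF) (hGF₂ : GF ≤ Real.exp (b₀ + B) * mm) :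
    Real.exp (-2 * B) * mp ≤ GT / (GT + GF) ∧ GT / (GT + GF) ≤ 1 - Real.exp (-2 * B) * mm := by
  have hem : 0 < Real.exp (b₀ - B) := Real.exp_pos _
  have hep : 0 < Real.exp (b₀ + B) := Real.exp_pos _
  have hGTpos : 0 < GT := lt_of_lt_of_le (mul_pos hem hmp) hGT₁
  have hGF0 : 0 ≤ GF := le_trans (mul_nonneg hem.le hmm) hGF₁
  have hS : 0 < GT + GF := by linarith
  have hS₂ : GT + GF ≤ Real.exp (b₀ + B) := by nlinarith
  have hkey : Real.exp (-2 * B) * Real.exp (b₀ + B) = Real.exp (b₀ - B) := by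
    rw [← Real.exp_add]; ring_nf
  constructor
  · rw [le_div_iff₀ hS]
    calc Real.exp (-2 * B) * mp * (GT + GF) ≤ Real.exp (-2 * B) * mp * Real.exp (b₀ + B) := by
          gcongr
      _ = Real.exp (b₀ - B) * mp := by rw [← hkey]; ring
      _ ≤ GT := hGT₁
  · have h1 : GT / (GT + GF) = 1 - GF / (GT + GF) := by field_simp; ring
    rw [h1]
    gcongr
    rw [le_div_iff₀ hS]
    calc Real.exp (-2 * B) * mm * (GT + GF) ≤ Real.exp (-2 * B) * mm * Real.exp (b₀ + B) := by
          gcongr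
      _ = Real.exp (b₀ - B) * mm := by rw [← hkey]; ring
      _ ≤ GF := hGF₁

end Summit.QuantumFields.QCD.Cruxes.WindowExtinction.FreeVolumeHeavyWitness

end
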